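import Summits.AtomisticToContinuum.Crystallization.Theses.SoftAnnulusKernel

/-!
# Route SoftAnnulusKernel — the Assembly item (stmt-AtomisticToContinuum-18408)

`Assembly := SoftLocalTwelveFourCommon → RobustTangencyBound → KernelGlueLocal → BondOrderTwelve → BondToShells →
ClosePackedCrystallizes → CrysPeriodicMinAttained → CrysEnergyLimit → Crystallization`: pure logic plus the
identification `⨅ = e(P)` for a least element (`IsLeast.csInf_eq`).  The route's deciding theorem `closes`
applies this item to its eight other hypotheses.
-/

namespace Summit.AtomisticToContinuum.Crystallization.Theorems

open Summit.AtomisticToContinuum.Crystallization.Theses.SoftAnnulusKernel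
open Literature.MathematicalPhysics.StatisticalMechanics

/-- **Assembly of route SoftAnnulusKernel** (item stmt-AtomisticToContinuum-18408). -/
theorem softAnnulusKernel_assembly_proof :
    Summit.AtomisticToContinuum.Crystallization.Theses.SoftAnnulusKernel.Assembly := by
  unfold Summit.AtomisticToContinuum.Crystallization.Theses.SoftAnnulusKernel.Assembly
  intro h_loc h_rob h_glue h_bond h_b2s h_hinge h_min h_lim
  -- the kernel from the rung, the target from bond order + kernel, the positional conjunct from the hinge
  have hK : GapFreeShellRigidity := h_glue h_loc h_rob
  have hLCP : LocalClosePacking := h_b2s h_bond hK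
  have hpos : IsCrystallizing lennardJones 3 := h_hinge hLCP
  -- energetic conjunct: a least periodic configuration `P`, `⨅ = e(P)`, and `E(N)/N → e(P)`
  obtain ⟨P, hleast⟩ := h_min
  have hinf : (⨅ Q : PeriodicConfiguration 3, Q.energyPerParticle lennardJones) =
      P.energyPerParticle lennardJones := hleast.csInf_eq
  have hlim : Filter.Tendsto (fun N : ℕ => groundStateEnergy lennardJones 3 N / N) Filter.atTop
      (nhds (P.energyPerParticle lennardJones)) := by
    have h0 : CrysEnergyLimit := h_lim
    unfold CrysEnergyLimit at h0
    rw [hinf] at h0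
    exact h0
  exact ⟨⟨P, hleast, hlim⟩, hpos⟩

end Summit.AtomisticToContinuum.Crystallization.Theorems
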